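import Mathlib
import HarnessLib
import HarnessLib.Audit
import Summits.QuantumFields.Statement
import Summits.QuantumFields.YangMills.Theses.UnitScaleTilt
import Literature.MathematicalPhysics.QuantumFieldTheory.Balaban1983to89.T3YM3TorusStatement
import HarnessLib.Audit.Status.Attr

/-!
Route: CoarseStiffnessTail

# Route CoarseStiffnessTail — rev 1 «unit-poly-tail»: a POWER-LAW unit-scale single-plaquette tail
supplies the history tail of rung R3; the capped coarse stiffness is one sufficient condition for it

LINE (D-0145 ideator seat ym-r3-idea-2: born g0, RE-TYPED g10 as LINE 20 = sub-route
«unit-poly-tail», lens «nearmiss»; bears_on LADDER-YM rung R3 = leaf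
`T3YM3TorusStatement.YM3TorusSU2` (RECORD: existence AND uniqueness of Bałaban's ultraviolet limit
of pure SU(2) Yang–Mills on the 3-torus), via crux stmt-QuantumFields-19936
`UnitScaleTilt.HistoryTailL`; NO summit and no Clay statement is proved by this line). It suffices
to show X = S1_poly = `UnitPolyTailL`: for every block size L and thresholds (b₁, p₁) there are a
profile (b₀, p₀) beyond them, an exponent s > 3, a constant C and γ₁ ∈ (0,1] such that for every
family F with F.L = L, every coupling 0 < γ ≤ γ₁, EVERY cut-off K and every plaquette a of the UNIT
lattice, the Wilson–Gibbs law of run K gives the event «the K-fold block-averaged plaquette variable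
Ū^K(∂a) deviates from 1 by at least Bałaban's unit-scale threshold θ_γ(0) = √γ·p(√γ)» probability at
most C·γ^s. No Gaussian rate, no rate constant, no joint event, no free energy: a POWER of the
unit-scale coupling with any exponent above the dimension d = 3, uniform in (K, m, γ ≤ γ₁) only —
the format Bałaban himself names as what controls large fields in d < 4 «until we reach the unit
lattice» ([Balaban1989LargeFieldI] p.175, after (0.1)). The kernel-checked chain of the seat
ym-line-cst-p1 (✓p685420, ✓p687579, companion OfCount) reads 25301 `CappedCoarseStiffnessL` ⇒ S1_top
⇒ S1_log ⇒ S1_poly ⇒ {19936, 27959}: X is the WEAKEST statement of the line that still closes, and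
the top slice suffices for ALL heights because the statement quantifies over every family of block
size L — the height-j tail of run j+d of F IS the top-slice tail of run j of F.refine d at coupling
γL^{−d} (✓`CoarseStiffnessTailUnitPolyTail.real_plaqLarge_refine`). Together with the two RESIDUAL
cruxes of the parent route UnitScaleTilt (stmt-QuantumFields-19200 `MinimiserStabilityRegPr`,
stmt-QuantumFields-20520 `FluctuationComparisonRegPrIntL`, restated byte-identically, attacked
THERE) and the provable glue `HistoryTailOfUnitPolyTail` (X ⇒ `HistoryTailL`, landed as
✓`historyTailL_of_unitPolyTail`), the parent's kernel-checked `closes` gives the leaf. The route's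
original crux `CappedCoarseStiffnessL` (one windowed-quadratic tilted partition function per RG
level, free energy O(1) per level-j plaquette) STAYS as a stronger sufficient condition — a standing
line toward X through the glue `UnitPolyTailOfStiffness` (landed as
✓`unitPolyTail_of_cappedCoarseStiffnessL`), with its registered skeleton v9 (stubs S1_top, S2_top)
and the seat's ≈ 50 helper files untouched.
Lean: `Summit.QuantumFields.YangMills.Theses.CoarseStiffnessTail.UnitPolyTailL`

CLOSES_TARGET: closes rung R3 of QuantumFields: Literature.MathematicalPhysics.QuantumFieldTheory.Balaban1983to89.T3YM3TorusStatement.YM3TorusSU2 (D-0061; not the summit Statement) — the deciding theorem of this route concludes that registered leaf instead of the Statement decl `YangMills` (class rung: servable and labelled, never counted as concluding the summit Statement).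

Rationale: WHY THIS LINE. Mechanism (lens «nearmiss»: an argument with a located deficit; the single input to
improve made the crux). The near miss is on the record twice. (i) The owner's landed (α)-record
chain `UnitScaleTiltHistoryTailLaneTailIntRows.perPlaquetteHighL_of_intCoreRecRows` delivers the
per-plaquette tail with the DEGRADED exponent −c·p(g)² + κ·(1 + log g⁻¹)^(2+3r₀): the collar volumes
R(g)³ of the large-field regions ([Balaban1985UV3] (39) p.266) eat into the Gaussian rate, and the
loss is absorbed only because the profile is chosen AFTER the constants (2p₀ > 2 + 3r₀). (ii) The
seat ym-line-cst-p1 (g14–g22, kernel files ✓p685420 `…UnitCountLogSlack`, ✓p687579 `…UnitPolyTail`,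
✓`…UnitPolyTailOfCount`) measured what the parent's binder 19936 actually consumes from the unit
scale: a union bound over ≍ L^(3(m+i)) plaquettes at depth i and the sum over the free top fraction
need the single-plaquette tail at unit coupling γ' to be O(γ'^s) for SOME s > 3 = d, uniformly in
cut-off and volume — NOTHING MORE; and the refinement orbit (the height-j tail of run j+d of F is
the top-slice tail of run j of F.refine d, `real_plaqLarge_refine`) makes the TOP SLICE suffice for
all heights. The original crux `CappedCoarseStiffnessL` (rev 0: one windowed-quadratic TILTED
PARTITION FUNCTION per level, free energy O(1) per plaquette with ONE rate constant c₀ for every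
profile) and its registered EDGE stub S1_top ask for strictly more than that — a uniform
Gaussian-rate exponential moment — which is exactly the format the collar entropy denies to a
transcription of print. Rev 1 therefore re-types the deciding crux to the format the near-miss
argument DELIVERS: X = S1_poly = `UnitPolyTailL`, a power law at the unit scale, the quantity
Bałaban names as controlling the large-field regions in d < 4 «until we reach the unit lattice»
([Balaban1989LargeFieldI] p.175: the one-plaquette Wilson factor (0.1) exp(−p₀(g₀)²) «can be
estimated by an arbitrarily large power of ε» for d < 4, so no R-operation is needed below four
dimensions). Imported: nothing new — the statement is the MEET of the route's own kernel chain
(25301 ⇒ S1_top ⇒ S1_log ⇒ S1_poly) and of the owner's chain output; what the re-type does that rev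
0 did not: it makes the weakest closing statement the served crux, so that (a) a siege on the
unit-scale large-field probability attacks S1_poly and not a free energy, (b) the owner's (α)-record
rows, once volume- and coupling-uniform, feed THIS route's `closes` through a pointwise absorption
lemma, and (c) `CappedCoarseStiffnessL` survives as ONE sufficient condition (glue
`UnitPolyTailOfStiffness`, landed) instead of the bottleneck. The negatives index (9 refuted
statements: SelfNormalisedSkewness 18944, CertificationLengthDiverges 16181, SandwichMoments 28261,
CurvatureAnchor 15826, RobustYangMillsRG 14958, DiagonalMirrorRP 9665, AdaptiveCoarseSystem 9494,
MultibosonLatticeGap 9599, AdmissibleRootsExist 9603) contains nothing on unit-scale plaquette tails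
of the Wilson–Gibbs law.

RANKED CRUXES. #2 UnitPolyTailL (crux, NEW, deciding) — S1_poly: ∀ L b₁ p₁ ∃ b₀ ≥ b₁, p₀ ≥ p₁ (0 <
b₀, 2 < p₀) ∃ s > 3, C ≥ 0, γ₁ ∈ (0,1] ∀ F (F.L = L) ∀ γ ∈ (0, γ₁] ∀ K ∀ a ∈ Plaq_K(top):
Gibbs_K{θBal(L,γ,b₀,p₀,0) ≤ dist1(Ū^K(∂a))} ≤ C·γ^s [difficulty: XL; the ultraviolet stability of
the unit-scale large-field probability, (71) of [Balaban1985UV3] at the LAST renormalisation steps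
integrated against the Gibbs law, uniformly in the cut-off]. #3 FluctuationComparisonRegPrIntL and
#4 MinimiserStabilityRegPr — the parent route's RESIDUAL cruxes (stmt-QuantumFields-20520, 19200),
byte-identical, attacked on route-QuantumFields-UnitScaleTilt. #5 CappedCoarseStiffnessL (crux, rev
0's deciding statement, KEPT as the stronger sufficient condition: registered skeleton v9 with stubs
S1_top / S2_top, seat ym-line-cst-p1's helper files; it implies #2 by the landed
`unitPolyTail_of_cappedCoarseStiffnessL`). Support (provable now, one-line files over landed
theorems): HistoryTailOfUnitPolyTail (#2 ⇒ `UnitScaleTilt.HistoryTailL`, =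
✓`historyTailL_of_unitPolyTail`), UnitPolyTailOfStiffness (#5 ⇒ #2, =
✓`unitPolyTail_of_cappedCoarseStiffnessL`); HistoryTailOfStiffness (rev 0 glue, CLOSED ✓p608186) and
Assembly (CLOSED) stay as proved records.

KILL CRITERIA. A refutation of UnitPolyTailL — a block size L and thresholds such that for EVERY
profile beyond them and every s > 3 the unit-scale tail is not O(γ^s) uniformly in K (e.g. a
K-growing prefactor, or a tail decaying slower than every power because the averaged variable's law
has a heavy non-Gaussian component at the threshold scale √γ·p(√γ)) — closes the route (`close
--reason refuted:UnitPolyTailL`) and kills EVERY supplier of 19936 at once (S1_poly is implied by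
25301, by S1_top/S1_log, and by the owner's per-plaquette high tail with any volume-uniform
constants), so it would re-target the whole R3 tail programme; a refutation of
CappedCoarseStiffnessL alone only retires that sufficient condition (drop #5, route stays on #2). A
refutation of either residual crux is the parent route's kill and moots this line with it. If 19936
is closed by another supplier first, this route is `superseded --by
route-QuantumFields-UnitScaleTilt`.

NOT DECOMPOSED YET. The registered birth skeleton of #2
(Cruxes/HistoryTailL/Lines/unit_poly_tail.lean) has two stubs: stub_topTailDegraded (the top-slice
per-plaquette tail with the collar-degraded Gaussian exponent −c·p(√γ)² + κ(1+log(√γ)⁻¹)^(2+3r₀) and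
a polynomial prefactor β₀^A, for every K — the organ-class content) and stub_absorb (degraded
Gaussian with 2p₀ > 2+3r₀ plus polynomial prefactor ≤ C·γ^s: real analysis, provable now); the split
of stub_topTailDegraded into Bałaban's inductive density representation at the last step and the
polymer counting of large-field histories ending at a is layer 2 and not filed; the bounded-depth
instances (K ≤ K₀, where the seat's compact-coupling files apply) are rungs, not items.

CHEAPEST FALSIFIER. (i) K = 0 (no averaging; run 0 is the Wilson law on the unit lattice at β =
γ⁻¹): the crux's instance is the single-plaquette Wilson tail Gibbs₀{√γ·p(√γ) ≤ |U(∂a) − 1|} ≤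
D·γ^(−A)·e^(−c·p(√γ)²) ≤ C·γ^s by the tree's chessboard tail
`T3FinestHeightTail.gibbsMeasure_real_dist1_ge_le` and `exp_neg_pFun_sq_le_pow` — the BC5 rung,
landed with this revision; a failure THERE would have killed the crux outright. (ii) GAUSSIAN
(lattice-Maxwell) instance: Ū^K(∂a) − 1 is centred Gaussian with variance ≤ c·γ uniformly in K
(SmallFieldWidening's landed GaussianRung), so the tail at √γ·p(√γ) is e^(−p²/(2c)) ≤ γ^s — PASSES.
(iii) INSTRUMENT ROW (kit; not run by this seat, kit_allowed = false): Monte-Carlo of P_top(K) at L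
= 2, m = 1, γ ∈ {1/4, 1/16}, (b₀,p₀) = (1,3), K ∈ {1,…,5}: the crux predicts log P_top(K) FLAT in K
at fixed γ and slope ≥ 3 in log γ; K-growth of P_top at fixed γ refutes the typed uniformity (row
L20-A on the card).

Novelty: NOVELTY (rev 1, D-0021; searches RUN by this seat g10, 2026-08-29). Nearest prior art FOUND: (a) in
the tree — seat ym-line-cst-p1's kernel chain ✓p685420
`CoarseStiffnessTailCappedCoarseStiffnessLUnitCountLogSlack`, ✓p687579
`CoarseStiffnessTailCappedCoarseStiffnessLUnitPolyTail` (`historyTailL_of_unitPolyTail`,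
`ym3TorusSU2_of_residuals_and_unitPolyTail`) and `…UnitPolyTailOfCount`
(`unitPolyTail_of_cappedCoarseStiffnessL`): S1_poly was TYPED there as a hypothesis of landed
theorems — this revision makes it the route's served crux (no listed route has it as an item: `lean
search 'UnitPolyTail'` → only those Theorems files; BC4 `example : UnitPolyTailL := by exact?`
fails); the owner's per-plaquette high-tail format
`UnitScaleTiltHistoryTailLaneTailIntRows.perPlaquetteHighL_of_intCoreRecRows` (degraded Gaussian
exponent, volume-dependent constants) is the nearest supplier and is NOT uniform in the cut-off as
typed. (b) in print — [Balaban1985UV3] (71) p.273 (the small factor exp(−¼p(g)²) per large-field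
plaquette inside the inductive representation, d = 3)
[corpus:paper:balaban1985-cmp102-uv-stability-3d p.19]; [Balaban1989LargeFieldI] p.175 «for d < 4 …
estimated by an arbitrarily large power of ε … until we reach the unit lattice»
[corpus:paper:balaban1989-cmp122-large-field-i p.1]; Dimock's expository re-derivation of Bałaban's
small-field/large-field split for φ⁴₃ (arXiv:1108.1335, [galaxy:pdf:4269152324782840500];
[Dimock2013BalabanII]) proves the analogue power-of-coup  [refs: 1108.1335, paper:balaban1985-cmp102-uv-stability-3d, paper:balaban1989-cmp122-large-field-i, King1986]

Barriers (technique_class: balaban-rg large-field small-factors; chessboard tail): - technique_class: balaban-rg large-field small-factors; chessboard tail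
- Literature.Barriers.QuantumFields.UVStabilityNonUniqueness
(`not_isUVStabilityConsequence_hasCutoffLimit`, `UVStabilityNonUniqueness_holds`): UnitPolyTailL is
INSIDE the class "bounds uniform in the cut-off" — it is itself a stability-type bound and claims no
limit; the barrier says such bounds alone never give the (unique) limit, and this route does not ask
them to: existence-and-uniqueness of rung R3 is carried by the two RESIDUAL cruxes
MinimiserStabilityRegPr (19200) and FluctuationComparisonRegPrIntL (20520) through the parent's
`closes`, where the tail is only the summable error budget. Evasion: by division of labour, not by
beating the barrier. [Literature/Barriers/QuantumFields/UVStabilityNonUniqueness.lean;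
corpus:paper:balaban1988-cmp119 Cor. 3 p.264 as quoted there]
- Literature.Barriers.QuantumFields.NonabelianCoulombPhaseD5 (`not_dimensionBlindClusteringSU2`,
conditional on the open conjecture): blocks dimension-blind devices aimed at a lattice MASS GAP /
clustering for SU(2)₄. This line claims neither: it is a d = 3 ULTRAVIOLET statement (rung R3, the
torus continuum limit), and its only lattice device with d-blind hypotheses — the chessboard bound —
is used for a single-plaquette TAIL at spacing-dependent coupling β = (γ ε_K)⁻¹ → ∞, where the d = 5
comparison theory has the same tail (no conflict with a Coulomb phase); the crux's γ^s with s > 3 =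
d is explicitly dimension-dependent (Bała

sub-problem: YangMills · status: open · opened planner-ym-r3-idea-2-g0-0 2026-08-28T03:26:17Z · rev 3 · ledger route-QuantumFields-CoarseStiffnessTail
GENERATED by the gate from the ledger (D-0016/17). Provers cite these decls: `theorem foo : Summit.QuantumFields.YangMills.Theses.CoarseStiffnessTail.<Decl> := …` in Summits/QuantumFields/YangMills/Theorems/<Name>.lean.
-/

namespace Summit.QuantumFields.YangMills.Theses.CoarseStiffnessTail

open scoped BigOperators Topology Manifold Classical MeasureTheory ProbabilityTheory Matrix InnerProductSpace ComplexConjugate ContinuousMap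
open Filter Set Function TopologicalSpace MeasureTheory

attribute [summit_statement] _root_.YangMills
attribute [summit_statement] _root_.Literature.MathematicalPhysics.QuantumFieldTheory.Balaban1983to89.T3YM3TorusStatement.YM3TorusSU2

/-- item stmt-QuantumFields-24027 · crux · rank 2 · open · by planner
why it might fail: Uniformity in the cut-off K is the content: (71) of Balaban1985UV3 bounds the unit-scale large-field DENSITY inside his inductive representation, not the integrated Gibbs probability; collar entropy (log 1/γ)^(3r0) per step or non-uniqueness of the representation could leave only K ≤ K0 or s ≤ 3.
sources: Balaban1985UV3, Balaban1989LargeFieldI, King1986, Dimock2013BalabanII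
[crux] S1_poly — POWER-LAW UNIT-SCALE SINGLE-PLAQUETTE TAIL (the re-typed deciding crux of rev 1,
LINE 20 «unit-poly-tail», lens nearmiss): for every block size L and thresholds (b₁,p₁) there are a
profile (b₀,p₀) beyond them (0<b₀, 2<p₀), an exponent s>3, C≥0 and γ₁∈(0,1] such that for every
family F with F.L=L, every coupling 0<γ≤γ₁, EVERY cut-off K and every top-level plaquette a, the
Wilson–Gibbs law gibbsK F ℰp γ K gives the event {θBal(L,γ,b₀,p₀,0) ≤ dist1(hol of the K-fold
block-averaged field around a)} probability ≤ C·γ^s. It is the weakest statement of the route's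
kernel chain CappedCoarseStiffnessL ⇒ S1_top ⇒ S1_log ⇒ S1_poly ⇒ UnitScaleTilt.HistoryTailL (all
implications landed: CoarseStiffnessTailCappedCoarseStiffnessLUnitPolyTail(.OfCount)); s>3=d is
exactly what the union bound over refined plaquettes and the sum over the top fraction consume; the
refinement orbit (real_plaqLarge_refine) turns the top slice into every height. Bałaban names the
quantity: in d<4 the one-plaquette factor exp(−p₀(g₀)²) «can be estimated by an arbitrarily large
power of ε … enough to control the large field regions … until we reach the unit lattice»
(Balaban1989LargeFieldI p.175). [bears_ -/
@[route_item "route-QuantumFields-CoarseStiffnessTail", crux]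
def UnitPolyTailL : Prop :=
  open Literature.MathematicalPhysics.QuantumFieldTheory.Balaban1983to89 Literature.MathematicalPhysics.QuantumFieldTheory.Balaban1983to89.T3ContinuumYM3Torus in ∀ (L : ℕ) (b₁ p₁ : ℝ), ∃ (b₀ p₀ : ℝ), b₁ ≤ b₀ ∧ p₁ ≤ p₀ ∧ 0 < b₀ ∧ 2 < p₀ ∧ ∃ (s C γ₁ : ℝ), 3 < s ∧ 0 ≤ C ∧ 0 < γ₁ ∧ γ₁ ≤ 1 ∧ ∀ (F : T3Family) (γ : ℝ), F.L = L → 0 < γ → γ ≤ γ₁ → ∀ (K : ℕ) (a : Plaq (F.P K) K), (T3UnitScaleTilt.gibbsK F T3UnitLawDensityEML.ℰp γ K).real {U | T3UnitScaleTilt.θBal F.L γ b₀ p₀ 0 ≤ GaugeGroup.dist1 (GaugeField.plaqHol (Averaging.iter (fun i => BlockAveraging.blockAvg (P := F.P K) (j := i) T3UnitLawDensityEML.ℰp) K U) a)} ≤ C * γ ^ s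

/-- item stmt-QuantumFields-20520 · crux · rank 3 · open · by operator
why it might fail: Cross-cut-off content UNPRINTED for non-abelian d=3: the King-slack two-run row at every co-height must come from the (α) record; excision removes only the window's EDGE clause — a failure in the window's body is not rescued by any c<1.
sources: Balaban1985UV3, King1986, Balaban1988Convergent, Balaban1989LargeFieldII, Balaban1985Variational
[crux] K1b-INT (E-INT interior excision of FluctuationComparisonRegPrL, OWNER RULING g22-№3 §B +
ADDENDUM 1; card C8 `edge-band-to-the-tail`): for every L there are an EXCISION RATIO 0 < c ≤ 1 and
THRESHOLDS (b₁, p₁) such that for every profile (b₀, p₀) with b₁ ≤ b₀, p₁ ≤ p₀, 0 < b₀, 2 < p₀ there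
is ε₁ > 0 such that for every 0 < ε₀ ≤ ε₁ there is m₀ such that for every m ≥ m₀ there is a
volume-uniform γ₁ > 0 such that for every T3Family F with F.L = L and 0 < γ ≤ γ₁,
`T3InteriorExcision.FluctuationComparisonRegPrIntAt F γ b₀ p₀ m c ε₀`: a.e. on the SHRUNK window
`PlaqSmall (θBal L γ (c·b₀) p₀ (K/m))` both restricted height densities of runs K and K+1 on the
histGood events at the ORIGINAL profile (b₀, p₀) are positive and log ρ + β·minActionRegPr of the
two runs agree modulo constants κ_K up to summable r_K (same body as FluctuationComparisonRegPrAt;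
only the a.e. guard is the c-window). FORMALLY WEAKER than FluctuationComparisonRegPrL (c = 1;
window monotone in b₀: `θBal_mono_b`), NO edge clause (the band {θ(c·b₀)-large, θ(b₀)-small} is
charged to HistoryTailL, whose profile floor absorbs the rescaling:
`T3InteriorExcision.unitTiltTail_of_interior`), and on the c-window print's χ -/
@[route_item "route-QuantumFields-CoarseStiffnessTail", crux]
def FluctuationComparisonRegPrIntL : Prop :=
  open Literature.MathematicalPhysics.QuantumFieldTheory.Balaban1983to89 Literature.MathematicalPhysics.QuantumFieldTheory.Balaban1983to89.T3ContinuumYM3Torus in ∀ (L : ℕ), ∃ (c b₁ p₁ : ℝ), 0 < c ∧ c ≤ 1 ∧ ∀ (b₀ p₀ : ℝ), b₁ ≤ b₀ → p₁ ≤ p₀ → 0 < b₀ → 2 < p₀ → ∃ ε₁ : ℝ, 0 < ε₁ ∧ ∀ (ε₀ : ℝ), 0 < ε₀ → ε₀ ≤ ε₁ → ∃ m₀ : ℕ, ∀ (m : ℕ), m₀ ≤ m → ∃ γ₁ : ℝ, 0 < γ₁ ∧ ∀ (F : T3Family) (γ : ℝ), F.L = L → 0 < γ → γ ≤ γ₁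 → T3InteriorExcision.FluctuationComparisonRegPrIntAt F γ b₀ p₀ m c ε₀

/-- item stmt-QuantumFields-19200 · crux · rank 4 · open · by operator
why it might fail: Uniformly over all small V the errors along the printed minimiser (interpolation ≈ B₃²b₀²p(g)²L^(K(5/m−2)), cubic averaging error) must be summable, m ≥ 3; INTERP unprinted, AVG-INEQ printed only for Federbush's averaging.
sources: Balaban1985Variational, Balaban1985RegularSpaces, Balaban1985UV3, King1986
[crux] K1aR-pr (E-min at the minimum over PRINT'S regular space (6) of Balaban1985Variational IN
FULL — both clauses of (2): small plaquette variables AND small covariant divergence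
Balaban1985RegularSpaces (1.9); replaces MinimiserStability stmt-QuantumFields-19822; supersedes
children-v2's plaquette-only MinimiserStabilityReg, which needed the unprinted gap G-K1aR-1 on top
of [7] Thm 1) — for every block size L there is ε₁(L) > 0 (the uniqueness radius a₀ of
Balaban1985Variational Thm 1, «depends on d and L only») such that for every 0 < ε₀ ≤ ε₁, all
sufficiently large m ≥ m₀(L, ε₀), every profile (b₀, p₀) and all 0 < γ ≤ γ₁(L, ε₀, m, b₀, p₀), every
T3Family F with F.L = L: `MinimiserStabilityRegPrAt F γ b₀ p₀ m ε₀` (tree module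
`T3PrintedRegularMinimiser` = `BgStabilityAt` at the printed backgrounds `bgRegPr`/`bgRegPr'`) —
summable r_K ≥ 0 and constants κ_K with, for every K and EVERY θBal(⌊K/m⌋)-small field V on the
comparison lattice, |β_{K+1}·minActionRegPr_{K+1}(V) − β_K·minActionRegPr_K(V) − κ_K| ≤ r_K (κ
idle), where minActionRegPr_K(V) = inf of the Wilson action over run K's fibre of V ∩ {|U(∂p) − 1| <
ε₀L^{-2(K−⌊K/m⌋)} ∀p} ∩ {‖(D^{1*}_U ∂U)(b)‖ < ε₀L^{-3(K−⌊K/m⌋)} ∀b} (d -/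
@[route_item "route-QuantumFields-CoarseStiffnessTail", crux]
def MinimiserStabilityRegPr : Prop :=
  open Literature.MathematicalPhysics.QuantumFieldTheory.Balaban1983to89 Literature.MathematicalPhysics.QuantumFieldTheory.Balaban1983to89.T3ContinuumYM3Torus in ∀ (L : ℕ), ∃ ε₁ : ℝ, 0 < ε₁ ∧ ∀ (ε₀ : ℝ), 0 < ε₀ → ε₀ ≤ ε₁ → ∃ m₀ : ℕ, ∀ (m : ℕ), m₀ ≤ m → ∀ (b₀ p₀ : ℝ), 0 < b₀ → 2 < p₀ → ∃ γ₁ : ℝ, 0 < γ₁ ∧ ∀ (F : T3Family) (γ : ℝ), F.L = L → 0 < γ → γ ≤ γ₁ → T3PrintedRegularMinimiser.MinimiserStabilityRegPrAt F γ b₀ p₀ m ε₀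

/-- item stmt-QuantumFields-25301 · support · rank 2 · open · by planner
why it might fail: One Gaussian-rate exponential moment constant c0 for every profile uniformly in K is strictly more than the power tail the assembly consumes; presumably true (Gaussian picture) but neither transcribable from print nor refutable by rows.
sources: Balaban1985UV3
[crux] CAPPED COARSE STIFFNESS (this line's one new obligation): ∀ L b₀ p₀ (0 < b₀, 2 < p₀) ∃ c₀ >
0, C₀, 0 < γ₁ ≤ 1 such that for every family F with F.L = L, every 0 < γ ≤ γ₁, every cut-off K and
height j ≤ K: ∫ exp(c₀·(γL^(−(K−j)))⁻¹·Σ_(a ∈ Plaq_j) min(dist1(Ū^j(∂a))², θBal(K−j)²)) dgibbsK ≤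
exp(C₀·#Plaq (F.P K) j) — the windowed-quadratic tilt of the level-j averaged plaquette field has
free energy O(1) per level-j plaquette, uniformly in K, j and the volume exponent m. [difficulty:
XL] -/
@[route_item "route-QuantumFields-CoarseStiffnessTail", crux]
def CappedCoarseStiffnessL : Prop :=
  open Literature.MathematicalPhysics.QuantumFieldTheory.Balaban1983to89 Literature.MathematicalPhysics.QuantumFieldTheory.Balaban1983to89.T3ContinuumYM3Torus in ∀ (L : ℕ) (b₀ p₀ : ℝ), 0 < b₀ → 2 < p₀ → ∃ (c₀ C₀ γ₁ : ℝ), 0 < c₀ ∧ 0 < γ₁ ∧ γ₁ ≤ 1 ∧ ∀ (F : T3Family) (γ : ℝ), F.L = L → 0 < γ → γ ≤ γ₁ → ∀ (K j : ℕ), j ≤ K → ∫ U, Real.exp (c₀ * (γ * ((F.L : ℝ)⁻¹) ^ (K - j))⁻¹ * ∑ a : Plaq (F.P K) j, min (GaugeGroup.dist1 (GaugeField.plaqHol (Averaging.iter (fun i => BlockAveraging.blockAvg (P := F.P K) (j := i) T3UnitLawDensityEML.ℰp) j U) a) ^ 2) (T3UnitScaleTilt.θBal F.L γ b₀ p₀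 (K - j) ^ 2)) ∂(T3UnitScaleTilt.gibbsK F T3UnitLawDensityEML.ℰp γ K) ≤ Real.exp (C₀ * (Fintype.card (Plaq (F.P K) j) : ℝ))

/-- item stmt-QuantumFields-24029 · support · rank 9 · closed · proved by Summit.QuantumFields.YangMills.Theorems.CoarseStiffnessTailHistoryTailOfUnitPolyTail.historyTailOfUnitPolyTail_proof (prover) · by planner
[support] glue (provable now, one line): S1_poly ⇒ the parent route's tail binder
stmt-QuantumFields-19936, by the landed
`Summit.QuantumFields.YangMills.Theorems.CoarseStiffnessTailUnitPolyTail.historyTailL_of_unitPolyTail`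
(✓p687579: refinement orbit + union bound over L^(3(m+i)) sub-plaquettes + summable top fraction;
needs s>3). Not inlined in `closes` because that module imports this route file. [deps:
UnitPolyTailL] [difficulty: provable-now] -/
@[route_item "route-QuantumFields-CoarseStiffnessTail", crux]
def HistoryTailOfUnitPolyTail : Prop :=
  UnitPolyTailL → Summit.QuantumFields.YangMills.Theses.UnitScaleTilt.HistoryTailL

-- `HistoryTailOfUnitPolyTail` holds: proved by `Summit.QuantumFields.YangMills.Theorems.CoarseStiffnessTailHistoryTailOfUnitPolyTail.historyTailOfUnitPolyTail_proof` (its module imports this route file, so no `_holds` link can be stated here).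

/-- item stmt-QuantumFields-24030 · support · rank 9 · closed · proved by Summit.QuantumFields.YangMills.Theorems.CoarseStiffnessTailUnitPolyTailOfStiffness.unitPolyTailOfStiffness_proof (prover) · by planner
[support] the standing line INTO the deciding crux (provable now, one line): rev 0's crux
CappedCoarseStiffnessL (stmt-QuantumFields-25301, seat ym-line-cst-p1, registered skeleton
Lines/birth.lean with stubs S1'/S2') implies S1_poly, by the landed
`Summit.QuantumFields.YangMills.Theorems.CoarseStiffnessTailUnitPolyTailOfCount.unitPolyTail_of_cappedCoarseStiffnessL`
(windowed tilt ⇒ unit large-field count ⇒ log-slack count ⇒ power tail via exp(−c·p(√γ)²) ≤ γ^N).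
Records that 25301 remains a sufficient condition for the route after the re-type. [deps:
UnitPolyTailL, CappedCoarseStiffnessL] [difficulty: provable-now] -/
@[route_item "route-QuantumFields-CoarseStiffnessTail"]
def UnitPolyTailOfStiffness : Prop :=
  CappedCoarseStiffnessL → UnitPolyTailL

-- `UnitPolyTailOfStiffness` holds: proved by `Summit.QuantumFields.YangMills.Theorems.CoarseStiffnessTailUnitPolyTailOfStiffness.unitPolyTailOfStiffness_proof` (its module imports this route file, so no `_holds` link can be stated here).

/-- item stmt-QuantumFields-25302 · support · rank 9 · closed · proved by Summit.QuantumFields.YangMills.Theorems.CoarseStiffnessTailHistoryTailOfStiffness.historyTailOfStiffness_proof (prover) · by planner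
sources: FrohlichIsraelLiebSimon1978, Balaban1985UV3
[support] THE GLUE (provable now, M): CappedCoarseStiffnessL ⇒ the body of
UnitScaleTilt.HistoryTailL (stmt-QuantumFields-19936). Given L, b₁, p₁ take b₀ = max b₁ 1, p₀ = max
p₁ 3 and (c₀, C₀, γ₁) from the crux; for t ≤ θ(K−j) the landed chessboard
`HistoryTailChessboardT3.chessboardRP_T3` (ρ = 1, Odd L from F.hL) bounds Gibbs_K(t ≤
dist1(Ū^j(∂p))) by Gibbs_K(∀ q ∈ S, t ≤ dist1(Ū^j(∂q)))^(1/#S); on that joint event Σ_(q∈S)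
min(dist1², θ²) ≥ #S·t², so exponential Chebyshev plus positivity of the remaining summands gives ≤
e^(−c₀β_(K−j)t²#S)·e^(C₀#Plaq_j), and #Plaq_j ≤ 3·#S·8(5L)³; at t = θ(K−j), β_(K−j)θ² = p(g_(K−j))²
(`T3FinestHeightTail.beta_mul_θBal_sq`) yields the per-plaquette schema with C = e^(3000L³C₀), A =
0, c = c₀, whence `T3AveragedTailProfile.averagedTailAt_of_perPlaquette` and
`T3BareTailProfile.historyTailAt_of_averagedTailAt` (0 < m, γ ≤ γ₁ ≤ 1). [difficulty: provable-now] -/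
@[route_item "route-QuantumFields-CoarseStiffnessTail"]
def HistoryTailOfStiffness : Prop :=
  open Literature.MathematicalPhysics.QuantumFieldTheory.Balaban1983to89 Literature.MathematicalPhysics.QuantumFieldTheory.Balaban1983to89.T3ContinuumYM3Torus in CappedCoarseStiffnessL → ∀ (L : ℕ) (b₁ p₁ : ℝ), ∃ (b₀ p₀ : ℝ), b₁ ≤ b₀ ∧ p₁ ≤ p₀ ∧ 0 < b₀ ∧ 2 < p₀ ∧ ∀ (m : ℕ), 0 < m → ∃ γ₁ : ℝ, 0 < γ₁ ∧ ∀ (F : T3Family) (γ : ℝ), F.L = L → 0 < γ → γ ≤ γ₁ → T3UnitScaleTilt.HistoryTailAt F γ b₀ p₀ m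

-- `HistoryTailOfStiffness` holds: proved by `Summit.QuantumFields.YangMills.Theorems.CoarseStiffnessTailHistoryTailOfStiffness.historyTailOfStiffness_proof` (its module imports this route file, so no `_holds` link can be stated here).

/-- item stmt-QuantumFields-25303 · assembly · rank 1 · closed · proved by Summit.QuantumFields.YangMills.Theorems.coarseStiffnessTail_assembly (prover) · by planner
sources: King1986, Balaban1985UV3
[assembly] MinimiserStabilityRegPr → FluctuationComparisonRegPrIntL → CappedCoarseStiffnessL →
HistoryTailOfStiffness → the leaf YM3TorusSU2 (rung R3; not the summit Statement). -/
@[route_item "route-QuantumFields-CoarseStiffnessTail"]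
def Assembly : Prop :=
  MinimiserStabilityRegPr → FluctuationComparisonRegPrIntL → CappedCoarseStiffnessL → HistoryTailOfStiffness → Literature.MathematicalPhysics.QuantumFieldTheory.Balaban1983to89.T3YM3TorusStatement.YM3TorusSU2

-- `Assembly` holds: proved by `Summit.QuantumFields.YangMills.Theorems.coarseStiffnessTail_assembly` (its module imports this route file, so no `_holds` link can be stated here).

/-! D-0027 §2.1 — DECIDING THEOREM (planner-authored via `route open/edit --closes-file`; by planner-ym-r3-idea-2-g10-0 2026-08-29T02:33:59Z):
its hypotheses are this route's items and its conclusion the registered leaf `Literature.MathematicalPhysics.QuantumFieldTheory.Balaban1983to89.T3YM3TorusStatement.YM3TorusSU2` (rung R3, D-0061) (glue_lint), and it elaborates with this file. -/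

@[closes "route-QuantumFields-CoarseStiffnessTail"] theorem closes (h200 : MinimiserStabilityRegPr) (h201 : FluctuationComparisonRegPrIntL) (hP : UnitPolyTailL)
    (hG : HistoryTailOfUnitPolyTail) :
    Literature.MathematicalPhysics.QuantumFieldTheory.Balaban1983to89.T3YM3TorusStatement.YM3TorusSU2 :=
  Summit.QuantumFields.YangMills.Theses.UnitScaleTilt.closes h200 h201 (hG hP)

end Summit.QuantumFields.YangMills.Theses.CoarseStiffnessTail
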